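import Summits.NavierStokesRegularity.NavierStokesRegularity.Theorems.ScalingDefectPeepholeDoorCoreLimit

/-!
# ScalingDefectPeepholeDoorCoreVorticity — door S30 «ScalingDefectPeepholeDoor» (nsreg-p1 g24 ROUND-28, `r28/Sketch30.lean`
# 0d39fe46f5f4f14c), plate P3 = LEG C `QuietCoreSliceRegular` (Pineau–Vicol 2026 Thm 1.9 in CORE form), part 2/3:
# ONE-SLICE SMALLNESS OF THE VORTICITY FROM A QUIET SIMILARITY CORE

The CORE-FORM twin of the tree theorem `Literature.Analysis.FluidPDE.pineauVicol_oneSlice_vorticity_small` (Pineau–Vicol 2026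
§9.3, (9.20)–(9.23), proved in the tree by compactness + Tsai): the self-similarity defect (1.17) is assumed small only on the
similarity core `B(0, L√(−t̄))` — `L = L(C_u, θ, R)` chosen BEFORE the pressure level — instead of on the whole physical ball `B₁`, and
the annular sup bound (1.16) on the pressure is replaced by the INTEGRAL pressure level `∫∫_{(−1,0)×B₁} |p|^{3/2} ≤ B_p` of the door
texts (the tree proof consumes (1.16) only through that integral, `exists_lintegral_pressure_rpow_threeHalves_le`).  WHY THE CORE FORM
HOLDS ALONG THE PRINTED/TREE PROOF (ROUND-28 §(1) LEG C, Remark 1.11 of the paper): negating `∃ δ₀ ∃ L ∀ B_p ∃ s₁ …` hands a contradiction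
sequence with `δₙ = 1/(n+2) → 0`, `Lₙ = n+2 → ∞` and pressure levels `B_{p,n}` absorbed by the lateness `Sₙ`; the cut-off similarity
profiles then solve Leray's profile system up to `δₙ` on `B̄(0, m+1)` for `n ≥ m` (because `Lₙ ≥ m+1`), which is all the limit needs —
the limit is a GLOBAL Leray profile in `L⁴`, zero by Tsai (part 1/3, `exists_curl_small_of_approxLerayProfiles`), contradicting the
largeness of the core vorticity.

* `coreDefect_vorticity_small` — `∀ C_u θ R, ∃ δ₀ ∈ (0,1], ∃ L ≥ 1, ∀ B_p, ∃ s₁ ≥ 1`: Type I (1.15) + `∫∫|p|^{3/2} ≤ B_p` +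
  `√(−t̄)·|(−t̄)∂ₜu − ½u − ½(x·∇)u| ≤ δ₀` on `B(0, L√(−t̄))` at one `t̄ ∈ (−e^{−s₁}, 0)` ⇒ `∫_{B(0,2R√(−t̄))} |ω(t̄)|² ≤ θ²/(4√(−t̄))`.

Steps 0–3 are the tree proof's, verbatim up to the new quantifier shape; Steps 4–8 are part 1/3.  Door S30 is a regularity CRITERION
inside a HYPOTHETICAL local Type-I blow-up (item 0056 `NoTypeII` stays OPEN); nothing here bears on NS regularity itself.
-/

noncomputable section

set_option linter.dupNamespace false

namespace Summit.NavierStokesRegularity.NavierStokesRegularity.Theorems.ScalingDefectPeepholeDoor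

open MeasureTheory Set Function Filter Metric TopologicalSpace InnerProductSpace
open scoped ENNReal NNReal InnerProductSpace RealInnerProductSpace Laplacian Topology
open Literature.Analysis Literature.Analysis.FluidPDE

-- nested operator types (`ℝ³ →L ℝ³ →L ℝ³`)
set_option maxSynthPendingDepth 3

set_option maxHeartbeats 3200000 in
/-- **One-slice smallness of the vorticity from a quiet similarity CORE** (core-form, integral-pressure twin of
`pineauVicol_oneSlice_vorticity_small`; the input of LEG C `QuietCoreSliceRegular` of door S30): for `C_u > 0`, `θ > 0`, `R ≥ 2`
there are `δ₀ ∈ (0,1]` and a core radius `L ≥ 1`, and for every pressure level `B_p` a lateness `s₁ ≥ 1`, such that a classical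
solution on `[−1,0) × B₁` (`ν = 1`, `f = 0`) with the Type I bound (1.15) and `∫∫_{(−1,0)×B₁} |p|^{3/2} ≤ B_p`, whose slice
`t̄ ∈ (−e^{−s₁}, 0)` has scale-normalised self-similarity defect `√(−t̄)·‖(−t̄)∂ₜu − ½u − ½(x·∇)u‖ ≤ δ₀` on the similarity core
`B(0, L√(−t̄))`, has `∫_{B(0, 2R√(−t̄))} |ω(t̄)|² ≤ θ²/(4√(−t̄))`.  Proof: by contradiction — `δₙ = 1/(n+2)`, `Lₙ = n+2`, the
cut-off similarity profiles `Fₙ(y) = cₙ(χuₙ(t̄ₙ))(cₙy)`, `cₙ = √(−t̄ₙ)`, are uniformly `C³`-bounded on balls (Lemma 9.2,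
`exists_forall_iteratedFDeriv_le_of_typeI_of_bounds`), divergence free, Type-I-enveloped and solve the profile system up to `δₙ` on
`B̄(0,m+1)`, `n ≥ m` (`cutoffProfile_eq'`; `cₙ(m+1) < Lₙcₙ`), so `exists_curl_small_of_approxLerayProfiles` contradicts
`∫_{B_{2R}}|curl Fₙ|² > θ²/4` (`lintegral_ball_curl_cutoffProfile'`).  [cite: PineauVicol2026, Thm 1.9 + Rem. 1.11, §9.3 (9.20)–(9.23),
arXiv:2607.09619 pp. 8, 52–53; Tsai1998 Thm 1] -/
theorem coreDefect_vorticity_small :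
    ∀ Cu : ℝ, 0 < Cu → ∀ θ : ℝ, 0 < θ → ∀ R : ℝ, 2 ≤ R → ∃ δ₀ : ℝ, 0 < δ₀ ∧ δ₀ ≤ 1 ∧ ∃ L : ℝ, 1 ≤ L ∧
      ∀ Bp : ℝ≥0, ∃ s₁ : ℝ, 1 ≤ s₁ ∧
      ∀ (u : ℝ → EuclideanSpace ℝ (Fin 3) → EuclideanSpace ℝ (Fin 3))
        (p : ℝ → EuclideanSpace ℝ (Fin 3) → ℝ),
        IsClassicalNSSolutionOnRegion
          (Ico (-1 : ℝ) 0 ×ˢ ball (0 : EuclideanSpace ℝ (Fin 3)) 1) 1 0 u p →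
        (∀ t ∈ Ico (-1 : ℝ) 0, ∀ x ∈ ball (0 : EuclideanSpace ℝ (Fin 3)) 1,
          ‖u t x‖ ≤ Cu / (Real.sqrt (-t) + ‖x‖)) →
        (∫⁻ w in Ioo (-1 : ℝ) 0 ×ˢ ball (0 : EuclideanSpace ℝ (Fin 3)) 1, ‖p w.1 w.2‖ₑ ^ (3 / 2 : ℝ) ≤ Bp) →
        ∀ tb : ℝ, -Real.exp (-s₁) < tb → tb < 0 →
          (∀ x ∈ ball (0 : EuclideanSpace ℝ (Fin 3)) (L * Real.sqrt (-tb)),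
            Real.sqrt (-tb) *
              ‖(-tb) • timeDerivOn (Ico (-1 : ℝ) 0 ×ˢ ball (0 : EuclideanSpace ℝ (Fin 3)) 1) u tb x
                  - (1 / 2 : ℝ) • u tb x - (1 / 2 : ℝ) • fderiv ℝ (u tb) x x‖ ≤ δ₀) →
          ∫⁻ x in ball (0 : EuclideanSpace ℝ (Fin 3)) (2 * R * Real.sqrt (-tb)),
              ENNReal.ofReal (‖curl (u tb) x‖ ^ 2) ≤
            ENNReal.ofReal (θ ^ 2 / (4 * Real.sqrt (-tb))) := by
  intro Cu hCu θ hθ R hR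
  have hR0 : 0 < R := by linarith
  by_contra H
  push Not at H
  /- Step 0: uniform constants. -/
  choose K hK0 HK using fun k : ℕ => exists_forall_iteratedFDeriv_le_of_typeI_of_bounds k Cu
  set Bu : ℝ≥0∞ := ENNReal.ofReal (Cu ^ 3) *
    ((∫⁻ t in Ioo (-1 : ℝ) 0, ENNReal.ofReal ((-t) ^ (-(1 / 4 : ℝ)))) *
      ∫⁻ x in ball (0 : EuclideanSpace ℝ (Fin 3)) 1, ENNReal.ofReal (‖x‖ ^ (-(5 / 2 : ℝ)))) with hBu_def
  have hBu : Bu < ⊤ := ENNReal.mul_lt_top ENNReal.ofReal_lt_top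
    (ENNReal.mul_lt_top lintegral_Ioo_neg_rpow_quarter_lt_top lintegral_ball_norm_rpow_lt_top)
  /- Step 1: the contradicting sequence. -/
  have Hn : ∀ n : ℕ, ∃ Bp : ℝ≥0, ∀ s₁ : ℝ, 1 ≤ s₁ →
      ∃ (u : ℝ → EuclideanSpace ℝ (Fin 3) → EuclideanSpace ℝ (Fin 3))
        (p : ℝ → EuclideanSpace ℝ (Fin 3) → ℝ),
        IsClassicalNSSolutionOnRegion
          (Ico (-1 : ℝ) 0 ×ˢ ball (0 : EuclideanSpace ℝ (Fin 3)) 1) 1 0 u p ∧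
        (∀ t ∈ Ico (-1 : ℝ) 0, ∀ x ∈ ball (0 : EuclideanSpace ℝ (Fin 3)) 1,
          ‖u t x‖ ≤ Cu / (Real.sqrt (-t) + ‖x‖)) ∧
        (∫⁻ w in Ioo (-1 : ℝ) 0 ×ˢ ball (0 : EuclideanSpace ℝ (Fin 3)) 1, ‖p w.1 w.2‖ₑ ^ (3 / 2 : ℝ) ≤ Bp) ∧
        ∃ tb : ℝ, -Real.exp (-s₁) < tb ∧ tb < 0 ∧
          (∀ x ∈ ball (0 : EuclideanSpace ℝ (Fin 3)) (((n : ℝ) + 2) * Real.sqrt (-tb)),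
            Real.sqrt (-tb) *
              ‖(-tb) • timeDerivOn (Ico (-1 : ℝ) 0 ×ˢ ball (0 : EuclideanSpace ℝ (Fin 3)) 1) u tb x
                  - (1 / 2 : ℝ) • u tb x - (1 / 2 : ℝ) • fderiv ℝ (u tb) x x‖ ≤ 1 / ((n : ℝ) + 2)) ∧
          ENNReal.ofReal (θ ^ 2 / (4 * Real.sqrt (-tb))) <
            ∫⁻ x in ball (0 : EuclideanSpace ℝ (Fin 3)) (2 * R * Real.sqrt (-tb)),
              ENNReal.ofReal (‖curl (u tb) x‖ ^ 2) := fun n =>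
    H (1 / ((n : ℝ) + 2)) (by positivity)
      (by rw [div_le_one (by positivity)]; linarith [(Nat.cast_nonneg n : (0 : ℝ) ≤ n)])
      ((n : ℝ) + 2) (by linarith [(Nat.cast_nonneg n : (0 : ℝ) ≤ n)])
  choose Bp H2 using Hn
  choose c₁ hc₁ Hd using fun (k : ℕ) (n : ℕ) => HK k Bu (Bp n) hBu ENNReal.coe_lt_top
  -- the common radius of validity of the derivative bounds of orders `0, …, 3`
  obtain ⟨cmin, hcmin_def⟩ : ∃ cmin : ℕ → ℝ, ∀ n,
      cmin n = min (min (c₁ 0 n) (c₁ 1 n)) (min (c₁ 2 n) (c₁ 3 n)) := ⟨_, fun _ => rfl⟩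
  have hcmin : ∀ n, 0 < cmin n := fun n => by
    rw [hcmin_def]; exact lt_min (lt_min (hc₁ 0 n) (hc₁ 1 n)) (lt_min (hc₁ 2 n) (hc₁ 3 n))
  have hcm0 : ∀ n, cmin n ≤ c₁ 0 n := fun n => by
    rw [hcmin_def]; exact (min_le_left _ _).trans (min_le_left _ _)
  have hcm1 : ∀ n, cmin n ≤ c₁ 1 n := fun n => by
    rw [hcmin_def]; exact (min_le_left _ _).trans (min_le_right _ _)
  have hcm2 : ∀ n, cmin n ≤ c₁ 2 n := fun n => by
    rw [hcmin_def]; exact (min_le_right _ _).trans (min_le_left _ _)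
  have hcm3 : ∀ n, cmin n ≤ c₁ 3 n := fun n => by
    rw [hcmin_def]; exact (min_le_right _ _).trans (min_le_right _ _)
  -- the size `Aₙ` the scale `cₙ = √(−t̄ₙ)` has to beat, and the corresponding `s₁`
  obtain ⟨A, hA_def⟩ : ∃ A : ℕ → ℝ, ∀ n,
      A n = ((n : ℝ) + 2) / cmin n + 2 * ((n : ℝ) + 2) + 4 * R + 1 := ⟨_, fun _ => rfl⟩
  have hA : ∀ n, 0 < A n := fun n => by
    rw [hA_def]
    have := hcmin n
    positivity
  obtain ⟨S, hS_def⟩ : ∃ S : ℕ → ℝ, ∀ n, S n = max 1 (2 * A n) := ⟨_, fun _ => rfl⟩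
  have hS1 : ∀ n, 1 ≤ S n := fun n => by rw [hS_def]; exact le_max_left _ _
  choose u p hreg hI hP tb htb1 htb0 hsl hbad using fun n => H2 n (S n) (hS1 n)
  /- Step 2: the scales `cₙ = √(−t̄ₙ)` are small. -/
  obtain ⟨c, hcdef⟩ : ∃ c : ℕ → ℝ, ∀ n, c n = Real.sqrt (-tb n) := ⟨_, fun _ => rfl⟩
  have hc : ∀ n, 0 < c n := fun n => by rw [hcdef]; exact Real.sqrt_pos.2 (by linarith [htb0 n])
  have htb1' : ∀ n, -1 < tb n := fun n => by
    have h1 : Real.exp (-S n) ≤ 1 := Real.exp_le_one_iff.2 (by linarith [hS1 n])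
    linarith [htb1 n]
  have hIoo : ∀ n, tb n ∈ Ioo (-1 : ℝ) 0 := fun n => ⟨htb1' n, htb0 n⟩
  have hcA : ∀ n, c n * A n < 1 := fun n => by
    have h1 : -tb n < Real.exp (-S n) := by linarith [htb1 n]
    have h2 : c n < Real.exp (-(S n) / 2) := by
      rw [hcdef, show -(S n) / 2 = -S n / 2 by ring, Real.exp_half]
      exact Real.sqrt_lt_sqrt (by linarith [htb0 n]) h1
    have h3 : Real.exp (-(S n) / 2) ≤ Real.exp (-A n) :=
      Real.exp_le_exp.2 (by linarith [le_max_right 1 (2 * A n), hS_def n])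
    have h4 : Real.exp (-A n) * A n < 1 := by
      have h5 : A n < Real.exp (A n) := by linarith [Real.add_one_le_exp (A n)]
      rw [Real.exp_neg]
      calc (Real.exp (A n))⁻¹ * A n < (Real.exp (A n))⁻¹ * Real.exp (A n) := by
            gcongr
        _ = 1 := inv_mul_cancel₀ (Real.exp_pos _).ne'
    calc c n * A n ≤ Real.exp (-A n) * A n :=
          mul_le_mul_of_nonneg_right (h2.trans_le h3).le (hA n).le
      _ < 1 := h4
  -- consequences of the smallness of `cₙ`
  have hcn1 : ∀ n, c n * ((n : ℝ) + 2) ≤ cmin n := fun n => by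
    have h1 : ((n : ℝ) + 2) / cmin n ≤ A n := by
      rw [hA_def]; linarith [hR0]
    have h2 : (n : ℝ) + 2 ≤ A n * cmin n := by
      rw [div_le_iff₀ (hcmin n)] at h1; linarith
    calc c n * ((n : ℝ) + 2) ≤ c n * (A n * cmin n) := by gcongr; exact (hc n).le
      _ = (c n * A n) * cmin n := by ring
      _ ≤ 1 * cmin n := by gcongr; exacts [(hcmin n).le, (hcA n).le]
      _ = cmin n := one_mul _
  have hcn2 : ∀ n, c n * ((n : ℝ) + 2) < 1 / 2 := fun n => by
    have h1 : 2 * ((n : ℝ) + 2) < A n := by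
      rw [hA_def]
      have := div_pos (by positivity : (0 : ℝ) < (n : ℝ) + 2) (hcmin n)
      linarith
    have h2 : c n * (2 * ((n : ℝ) + 2)) < c n * A n := by gcongr; exact hc n
    linarith [hcA n]
  have hcn3 : ∀ n, 2 * R * c n ≤ 1 / 2 := fun n => by
    have h1 : 4 * R < A n := by
      rw [hA_def]
      have := div_pos (by positivity : (0 : ℝ) < (n : ℝ) + 2) (hcmin n)
      have : (0 : ℝ) ≤ n := Nat.cast_nonneg n
      linarith
    have h2 : c n * (4 * R) < c n * A n := by gcongr; exact hc n
    linarith [hcA n]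
  /- Step 3: the cut-off and the profiles. -/
  let χb : ContDiffBump (0 : EuclideanSpace ℝ (Fin 3)) := ⟨1 / 2, 3 / 4, by norm_num, by norm_num⟩
  obtain ⟨χ, hχdef⟩ : ∃ χ : EuclideanSpace ℝ (Fin 3) → ℝ, χ = ⇑χb := ⟨_, rfl⟩
  have hχ : ContDiff ℝ (⊤ : ℕ∞) χ := by rw [hχdef]; exact χb.contDiff
  have hχs : tsupport χ ⊆ ball (0 : EuclideanSpace ℝ (Fin 3)) 1 := by
    rw [hχdef, χb.tsupport_eq]
    exact closedBall_subset_ball (by norm_num)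
  have hχ1 : ∀ x ∈ ball (0 : EuclideanSpace ℝ (Fin 3)) (1 / 2), ∀ᶠ z in 𝓝 x, χ z = 1 :=
    fun x hx => by
      have h := χb.eventuallyEq_one_of_mem_ball hx
      rw [hχdef]
      exact h.mono fun z hz => by simpa using hz
  have hχabs : ∀ x, |χ x| ≤ 1 := fun x => by
    rw [hχdef]
    exact abs_le.2 ⟨by linarith [χb.nonneg (x := x)], χb.le_one⟩
  have hχ0 : ∀ x, x ∉ ball (0 : EuclideanSpace ℝ (Fin 3)) 1 → χ x = 0 := fun x hx =>
    image_eq_zero_of_notMem_tsupport fun h => hx (hχs h)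
  have hsec : ∀ n, spaceSection (Ico (-1 : ℝ) 0 ×ˢ ball (0 : EuclideanSpace ℝ (Fin 3)) 1) (tb n) =
      ball 0 1 := fun n => spaceSection_prod (Ioo_subset_Ico_self (hIoo n)) _
  have hus : ∀ n, ContDiffOn ℝ (⊤ : ℕ∞) (u n (tb n)) (ball (0 : EuclideanSpace ℝ (Fin 3)) 1) :=
    fun n => by have := (hreg n).contDiffOn_velocity (tb n); rwa [hsec n] at this
  have hps : ∀ n, ContDiffOn ℝ (⊤ : ℕ∞) (p n (tb n)) (ball (0 : EuclideanSpace ℝ (Fin 3)) 1) :=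
    fun n => by have := (hreg n).contDiffOn_pressure (tb n); rwa [hsec n] at this
  obtain ⟨F, hFdef⟩ : ∃ F : ℕ → EuclideanSpace ℝ (Fin 3) → EuclideanSpace ℝ (Fin 3),
      ∀ n, F n = fun y => c n • (χ (c n • y) • u n (tb n) (c n • y)) := ⟨_, fun _ => rfl⟩
  obtain ⟨Qf, hQdef⟩ : ∃ Qf : ℕ → EuclideanSpace ℝ (Fin 3) → ℝ,
      ∀ n, Qf n = fun y => c n ^ 2 * (χ (c n • y) * p n (tb n) (c n • y)) := ⟨_, fun _ => rfl⟩
  have hFs : ∀ n, ContDiff ℝ (⊤ : ℕ∞) (F n) := fun n => by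
    rw [hFdef]
    exact ((contDiff_cutoff_smul_of_contDiffOn isOpen_ball hχ hχs (hus n)).comp
      (contDiff_id.const_smul (c n))).const_smul (c n)
  have hQs : ∀ n, ContDiff ℝ (⊤ : ℕ∞) (Qf n) := fun n => by
    rw [hQdef]
    exact ((contDiff_cutoff_smul_of_contDiffOn isOpen_ball hχ hχs (hps n)).comp
      (contDiff_id.const_smul (c n))).const_smul (c n ^ 2)
  have hF3 : ∀ n, ContDiff ℝ 3 (F n) := fun n => contDiff_infty.1 (hFs n) 3
  have hQ1 : ∀ n, ContDiff ℝ 1 (Qf n) := fun n => contDiff_infty.1 (hQs n) 1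
  have hQd : ∀ n, Differentiable ℝ (Qf n) := fun n => (hQ1 n).differentiable one_ne_zero
  -- where the bounds hold
  have hgood : ∀ m n : ℕ, m ≤ n → ∀ y ∈ closedBall (0 : EuclideanSpace ℝ (Fin 3)) ((m : ℝ) + 1),
      c n * (1 + ‖y‖) ≤ cmin n ∧ c n • y ∈ ball (0 : EuclideanSpace ℝ (Fin 3)) (1 / 2) ∧
        c n • y ∈ ball (0 : EuclideanSpace ℝ (Fin 3)) 1 ∧
        c n • y ∈ ball (0 : EuclideanSpace ℝ (Fin 3)) (((n : ℝ) + 2) * Real.sqrt (-tb n)) := by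
    intro m n hmn y hy
    rw [mem_closedBall_zero_iff] at hy
    have hmn' : (m : ℝ) ≤ n := by exact_mod_cast hmn
    have h1 : c n * (1 + ‖y‖) ≤ c n * ((n : ℝ) + 2) :=
      mul_le_mul_of_nonneg_left (by linarith) (hc n).le
    have hny : c n * ‖y‖ ≤ c n * ((n : ℝ) + 1) :=
      mul_le_mul_of_nonneg_left (by linarith [norm_nonneg y]) (hc n).le
    have h2 : ‖c n • y‖ < 1 / 2 := by
      rw [norm_smul, Real.norm_of_nonneg (hc n).le]
      have : c n * ((n : ℝ) + 1) ≤ c n * ((n : ℝ) + 2) :=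
        mul_le_mul_of_nonneg_left (by linarith) (hc n).le
      linarith [hcn2 n]
    have h3 : ‖c n • y‖ < ((n : ℝ) + 2) * Real.sqrt (-tb n) := by
      rw [norm_smul, Real.norm_of_nonneg (hc n).le, ← hcdef n]
      have : c n * ((n : ℝ) + 1) < c n * ((n : ℝ) + 2) := mul_lt_mul_of_pos_left (by linarith) (hc n)
      linarith
    exact ⟨h1.trans (hcn1 n), mem_ball_zero_iff.2 h2, mem_ball_zero_iff.2 (by linarith),
      mem_ball_zero_iff.2 h3⟩
  -- the Type I bound of the profiles (everywhere)
  have hFI : ∀ n y, ‖F n y‖ ≤ Cu / (1 + ‖y‖) := by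
    intro n y
    rw [hFdef]
    dsimp only
    by_cases hy : c n • y ∈ ball (0 : EuclideanSpace ℝ (Fin 3)) 1
    · have hIu := hI n (tb n) (Ioo_subset_Ico_self (hIoo n)) (c n • y) hy
      rw [← hcdef n, norm_smul, Real.norm_of_nonneg (hc n).le,
        show c n + c n * ‖y‖ = c n * (1 + ‖y‖) by ring] at hIu
      have hpos : 0 < 1 + ‖y‖ := by positivity
      rw [norm_smul, norm_smul, Real.norm_of_nonneg (hc n).le, Real.norm_eq_abs]
      calc c n * (|χ (c n • y)| * ‖u n (tb n) (c n • y)‖)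
          ≤ c n * (1 * (Cu / (c n * (1 + ‖y‖)))) :=
            mul_le_mul_of_nonneg_left
              (mul_le_mul (hχabs _) hIu (norm_nonneg _) zero_le_one) (hc n).le
        _ = Cu / (1 + ‖y‖) := by
            rw [one_mul, ← mul_div_assoc, mul_div_mul_left _ _ (hc n).ne']
    · rw [hχ0 _ hy, zero_smul, smul_zero, norm_zero]
      positivity
  -- the `L³` bound of `uₙ` and the `L^{3/2}` bound of `pₙ`
  have hintU : ∀ n, ∫⁻ w in Ioo (-1 : ℝ) 0 ×ˢ ball (0 : EuclideanSpace ℝ (Fin 3)) 1,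
      ‖u n w.1 w.2‖ₑ ^ (3 : ℕ) ≤ Bu := fun n => by
    calc ∫⁻ w in Ioo (-1 : ℝ) 0 ×ˢ ball (0 : EuclideanSpace ℝ (Fin 3)) 1, ‖u n w.1 w.2‖ₑ ^ (3 : ℕ)
        = ∫⁻ w in Ioo (-1 : ℝ) 0 ×ˢ ball (0 : EuclideanSpace ℝ (Fin 3)) 1,
            ENNReal.ofReal (‖u n w.1 w.2‖ ^ 3) :=
          lintegral_congr fun w => by
            rw [← ofReal_norm, ← ENNReal.ofReal_pow (norm_nonneg _)]
      _ ≤ Bu := lintegral_typeI_cube_le (hI n)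
  have hintP : ∀ n, ∫⁻ w in Ioo (-1 : ℝ) 0 ×ˢ ball (0 : EuclideanSpace ℝ (Fin 3)) (1 / 32),
      ‖p n w.1 w.2‖ₑ ^ (3 / 2 : ℝ) ≤ (Bp n : ℝ≥0∞) := fun n =>
    (lintegral_mono_set (prod_mono Subset.rfl (ball_subset_ball (by norm_num)))).trans (hP n)
  -- the derivative bounds of orders `0, …, 3` on `B̄(0, m+1)` for `n ≥ m`
  have hDk : ∀ k m n : ℕ, m ≤ n → cmin n ≤ c₁ k n →
      ∀ y ∈ closedBall (0 : EuclideanSpace ℝ (Fin 3)) ((m : ℝ) + 1),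
        ‖iteratedFDeriv ℝ k (F n) y‖ ≤ K k := by
    intro k m n hmn hk y hy
    obtain ⟨hsm, hcy, -, -⟩ := hgood m n hmn y hy
    have h := norm_iteratedFDeriv_cutoffProfile_le'
      (Hd k n (u n) (p n) (hreg n) (hI n) (hintU n) (hintP n)) (hreg n) hχ hχs (hIoo n) (hcdef n)
      (hFdef n) (hχ1 _ hcy) (hsm.trans hk)
    refine h.trans (div_le_self (hK0 k) (one_le_pow₀ (by linarith [norm_nonneg y])))
  obtain ⟨Kmax, hKmax_def⟩ : ∃ Kmax : ℝ, Kmax = max (max (K 0) (K 1)) (max (K 2) (K 3)) := ⟨_, rfl⟩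
  have hbB : ∀ m n : ℕ, m ≤ n → ∀ y ∈ closedBall (0 : EuclideanSpace ℝ (Fin 3)) ((m : ℝ) + 1),
      ‖F n y‖ ≤ Kmax ∧ ‖fderiv ℝ (F n) y‖ ≤ Kmax ∧ ‖fderiv ℝ (fderiv ℝ (F n)) y‖ ≤ Kmax ∧
        ‖fderiv ℝ (fderiv ℝ (fderiv ℝ (F n))) y‖ ≤ Kmax := by
    intro m n hmn y hy
    refine ⟨?_, ?_, ?_, ?_⟩
    · rw [← norm_iteratedFDeriv_zero (𝕜 := ℝ) (f := F n)]
      exact (hDk 0 m n hmn (hcm0 n) y hy).trans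
        (by rw [hKmax_def]; exact (le_max_left _ _).trans (le_max_left _ _))
    · rw [← norm_iteratedFDeriv_zero (𝕜 := ℝ) (f := fderiv ℝ (F n)), norm_iteratedFDeriv_fderiv]
      exact (hDk 1 m n hmn (hcm1 n) y hy).trans
        (by rw [hKmax_def]; exact (le_max_right _ _).trans (le_max_left _ _))
    · rw [← norm_iteratedFDeriv_zero (𝕜 := ℝ) (f := fderiv ℝ (fderiv ℝ (F n))),
        norm_iteratedFDeriv_fderiv, norm_iteratedFDeriv_fderiv]
      exact (hDk 2 m n hmn (hcm2 n) y hy).trans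
        (by rw [hKmax_def]; exact (le_max_left _ _).trans (le_max_right _ _))
    · rw [← norm_iteratedFDeriv_zero (𝕜 := ℝ) (f := fderiv ℝ (fderiv ℝ (fderiv ℝ (F n)))),
        norm_iteratedFDeriv_fderiv, norm_iteratedFDeriv_fderiv, norm_iteratedFDeriv_fderiv]
      exact (hDk 3 m n hmn (hcm3 n) y hy).trans
        (by rw [hKmax_def]; exact (le_max_right _ _).trans (le_max_right _ _))
  /- Step 4: the hypotheses of the compactness–Liouville lemma: divergence and the profile system up to `δₙ`. -/
  have hdiv0 : ∀ m n : ℕ, m ≤ n → ∀ y ∈ closedBall (0 : EuclideanSpace ℝ (Fin 3)) ((m : ℝ) + 1),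
      VectorCalculus.divergence (F n) y = 0 := fun m n hmn y hy => by
    obtain ⟨-, hcy, hcy1, -⟩ := hgood m n hmn y hy
    exact divergence_cutoffProfile_eq_zero' (hreg n) (htb1' n) (htb0 n) (hcdef n) (hFdef n) hcy1 (hχ1 _ hcy)
  have hEq : ∀ m n : ℕ, m ≤ n → ∀ y ∈ closedBall (0 : EuclideanSpace ℝ (Fin 3)) ((m : ℝ) + 1),
      ‖-((Δ (F n)) y) + (1 / 2 : ℝ) • F n y + (1 / 2 : ℝ) • fderiv ℝ (F n) y y + convect (F n) (F n) y +
          gradient (Qf n) y‖ ≤ 1 / ((n : ℝ) + 2) := fun m n hmn y hy => by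
    obtain ⟨-, hcy, hcy1, hcyL⟩ := hgood m n hmn y hy
    rw [cutoffProfile_eq' (hreg n) (htb1' n) (htb0 n) (hcdef n) (hFdef n) (hQdef n) hcy1 (hχ1 _ hcy),
      norm_neg, norm_smul, Real.norm_of_nonneg (hc n).le]
    have h := hsl n (c n • y) hcyL
    rwa [← hcdef n] at h
  /- Step 5: the compactness–Liouville lemma against the largeness of the vorticity in similarity variables. -/
  obtain ⟨n, hn⟩ := exists_curl_small_of_approxLerayProfiles hCu F Qf hF3 hQd hbB hFI hdiv0 hEq θ hθ R hR0
  have hlow : ENNReal.ofReal (θ ^ 2 / 4) <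
      ∫⁻ y in ball (0 : EuclideanSpace ℝ (Fin 3)) (2 * R), ENNReal.ofReal (‖curl (F n) y‖ ^ 2) := by
    have hb := hbad n
    rw [← hcdef n] at hb
    rw [lintegral_ball_curl_cutoffProfile' hχ1 (htb0 n) (hcdef n) (hFdef n) hR0 (hcn3 n)]
    have hc0 : ENNReal.ofReal (c n) ≠ 0 := (ENNReal.ofReal_pos.2 (hc n)).ne'
    have hcne : c n ≠ 0 := (hc n).ne'
    calc ENNReal.ofReal (θ ^ 2 / 4)
        = ENNReal.ofReal (c n) * ENNReal.ofReal (θ ^ 2 / (4 * c n)) := by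
          rw [← ENNReal.ofReal_mul (hc n).le, ← mul_div_assoc, mul_comm (c n) (θ ^ 2),
            mul_div_mul_right _ _ hcne]
      _ < ENNReal.ofReal (c n) *
          ∫⁻ x in ball (0 : EuclideanSpace ℝ (Fin 3)) (2 * R * c n),
            ENNReal.ofReal (‖curl (u n (tb n)) x‖ ^ 2) :=
          ENNReal.mul_lt_mul_right hc0 ENNReal.ofReal_ne_top hb
  exact lt_irrefl _ (hlow.trans_le hn)

end Summit.NavierStokesRegularity.NavierStokesRegularity.Theorems.ScalingDefectPeepholeDoor

end
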